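import Summits.BirchSwinnertonDyer.BirchSwinnertonDyer.Theorems.GenusKolyvaginAtTwoGenusPrimitiveSupplyAtTwoTwistingPrimeDepthTwoInflation
import HarnessLib

/-!
# Route `GenusKolyvaginAtTwo`, crux #2 `GenusPrimitiveSupplyAtTwo` (stmt-BirchSwinnertonDyer-22136):
# the level-`k` data of `Γ_{ℚ(E[2^k])}` on `E[2^{k+1}]`, their squaring laws, and `Hom_{GL₂(𝔽₂)}(M₂(𝔽₂)/⟨A + A²⟩, 𝔽₂²) = 0`

Width seat `bsd-line-gk2-p4` g10, cell `bsd-f1-sign2`; helper (`--supports stmt-BirchSwinnertonDyer-22136`),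
continuing the twisting-prime series (§40–§42 after g9's §39); first of three files proving that ENTANGLEMENT IS
A LEVEL-`4` PHENOMENON (sequel `…TwistingPrimeLevelFour`: a class of `H¹(ℚ, E[2])` dying on `Γ_{ℚ(E[2^M])}`
already dies on `Γ_{ℚ(E[4])}`, i.e. `H¹(GL₂(ℤ/2^M), 𝔽₂²) = H¹(GL₂(ℤ/4), 𝔽₂²)` for all `M ≥ 2`). THEOREMS ONLY:
no definition, no named fact, no `sorry`; no item is closed; BSD is not proved by any of this.

CONTENT (group theory of `U = ker(GL₂(ℤ₂) → GL₂(𝔽₂))`, written element-wise on `E[2^k] ⊂ E(ℚ̄)`; g8's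
`…TwistingPrimeDepthTwoUnipotent` §24 is the case `k = 1`).
* §40 For `g ∈ Γ_{ℚ(E[2^k])}` (`k ≥ 1`) the LEVEL-`k` DATUM is the additive `A : E[2] → E[2]` with
  `gP = P + A(2^k P)` on `E[2^{k+1}]` — the matrix `1 + 2^k A` of `g` in `U^{(k)}/U^{(k+1)} ≅ M₂(𝔽₂)`; expressed
  throughout by the hypothesis `∀ P v, 2^k P = v → gP = P + A v` (no new definition). It exists
  (`exists_datum_of_mem_torsionFixing_zpow`), determines `g` modulo `Γ_{ℚ(E[2^{k+1}])}`
  (`mul_inv_mem_torsionFixing_zpow_succ_of_datum`), is additive in `g` (`datum_mul`), conjugates like `τAτ⁻¹`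
  (`datum_conj`), and every `A` occurs when `ρ_{E,2^{k+1}}` is onto (`exists_datum_eq_of_hasSurjectiveModNGaloisRep`).
* §41 SQUARING: for `k ≥ 2` the level-`(k+1)` datum of `g²` is AGAIN `A` (`datum_sq_of_two_le`:
  `(1 + 2^k A)² ≡ 1 + 2^{k+1} A`), while at `k = 1` it is `A + A²` (`datum_sq_one`: `(1 + 2A)² = 1 + 4(A + A²)`).
* §42 `twoByTwo_equivariant_eq_zero_of_sq`: an additive `GL₂(𝔽₂)`-equivariant `M₂(𝔽₂) → 𝔽₂²` killing every
  `A + A²` is zero (`{A + A²}` spans the trace-zero matrices; the trace is a trivial `GL₂(𝔽₂)`-module and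
  `(𝔽₂²)^{GL₂(𝔽₂)} = 0`) — a `decide`-level computation on top of g8's `twoByTwo_equivariant_eq_zero`.

References: [LawsonWuthrich2016] §3 (Lemma 6, the case p = 2); [Serre1972] §4; [GrossLMS1991] §9.
-/

set_option linter.dupNamespace false -- tree convention: `Summit.BirchSwinnertonDyer.BirchSwinnertonDyer.Theorems` (summit = sub-problem)
set_option autoImplicit false

noncomputable section

open scoped Classical Pointwise

namespace Summit.BirchSwinnertonDyer.BirchSwinnertonDyer.Theorems.GenusKolyTwistingPrime

open WeierstrassCurve NumberField IsDedekindDomain Field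
open Literature.NumberTheory.GaloisRepresentations Literature.NumberTheory.EllipticCurves
open Literature.NumberTheory Matrix

/-! ## §40 The level-`k` datum `A` of `g ∈ Γ_{ℚ(E[2^k])}`: `gP = P + A(2^k P)` on `E[2^{k+1}]`

Throughout, the datum of `g` at level `k` is expressed by the hypothesis
`∀ (P : E(ℚ̄)) (v ∈ E[2]), 2^k P = v → gP = P + A v` (no new definition). -/

section Datum

variable (W : WeierstrassCurve ℚ)

/-- `2^k P ∈ E[2]` forces `2^{k+1} P = 0`. [folklore] -/
theorem zpow_succ_zsmul_eq_zero_of_zpow_zsmul_eq {k : ℕ} {P : geomPoints W} {v : geomTorsion W (2 : ℤ)}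
    (hP : ((2 : ℤ) ^ k) • P = (v : geomPoints W)) : ((2 : ℤ) ^ (k + 1)) • P = 0 := by
  rw [pow_succ', mul_zsmul, hP]
  exact (WeierstrassCurve.mem_geomTorsion_iff W 2 _).mp v.2

/-- An element of `Γ_{ℚ(E[2^k])}` fixes every `Q` with `2^k Q = 0`. [folklore] -/
theorem smul_eq_self_of_zpow_zsmul_eq_zero {k : ℕ} {g : absoluteGaloisGroup ℚ}
    (hg : g ∈ torsionFixing W ((2 : ℤ) ^ k)) {Q : geomPoints W} (hQ : ((2 : ℤ) ^ k) • Q = 0) : g • Q = Q := by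
  have hmem : Q ∈ geomTorsion W ((2 : ℤ) ^ k) := (WeierstrassCurve.mem_geomTorsion_iff W _ Q).mpr hQ
  have h := smul_eq_of_mem_torsionFixing W ((2 : ℤ) ^ k) hg ⟨Q, hmem⟩
  exact congrArg (fun x : geomTorsion W ((2 : ℤ) ^ k) ↦ (x : geomPoints W)) h

/-- `2^k v = 0` for `v ∈ E[2]` and `k ≥ 1`. [folklore] -/
theorem zpow_zsmul_coe_geomTorsion_two {k : ℕ} (hk : 1 ≤ k) (v : geomTorsion W (2 : ℤ)) :
    ((2 : ℤ) ^ k) • (v : geomPoints W) = 0 := by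
  obtain ⟨j, rfl⟩ := Nat.exists_eq_add_of_le hk
  rw [add_comm, pow_succ', mul_comm, mul_zsmul, (WeierstrassCurve.mem_geomTorsion_iff W 2 _).mp v.2, zsmul_zero]

/-- An element of `Γ_{ℚ(E[2^k])}` (`k ≥ 1`) fixes `E[2]`. [folklore] -/
theorem smul_coe_geomTorsion_two_of_mem_torsionFixing_zpow {k : ℕ} (hk : 1 ≤ k) {g : absoluteGaloisGroup ℚ}
    (hg : g ∈ torsionFixing W ((2 : ℤ) ^ k)) (v : geomTorsion W (2 : ℤ)) : g • (v : geomPoints W) = v :=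
  smul_eq_self_of_zpow_zsmul_eq_zero W hg (zpow_zsmul_coe_geomTorsion_two W hk v)

/-- **`gP − P` depends only on `2^k P`** for `g ∈ Γ_{ℚ(E[2^k])}`. [folklore] -/
theorem smul_sub_eq_smul_sub_of_zpow_zsmul_eq {k : ℕ} {g : absoluteGaloisGroup ℚ}
    (hg : g ∈ torsionFixing W ((2 : ℤ) ^ k)) {P P' : geomPoints W}
    (h : ((2 : ℤ) ^ k) • P = ((2 : ℤ) ^ k) • P') : g • P - P = g • P' - P' := by
  have h0 : g • (P - P') = P - P' :=
    smul_eq_self_of_zpow_zsmul_eq_zero W hg (by rw [zsmul_sub, h, sub_self])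
  rw [smul_sub] at h0
  rw [← sub_eq_zero]
  have : g • P - P - (g • P' - P') = (g • P - g • P') - (P - P') := by abel
  rw [this, h0, sub_self]

/-- **EXISTENCE OF THE LEVEL-`k` DATUM.** Every `g ∈ Γ_{ℚ(E[2^k])}` (`k ≥ 1`) acts on `E[2^{k+1}]` as
`P ↦ P + A(2^k P)` for a unique additive `A : E[2] → E[2]` (`A(v) := gP − P` for any `P` with `2^k P = v`;
well defined and additive because `g` fixes `E[2^k]`; uses the `2^k`-divisibility of `E(ℚ̄)`). These are the
elements `1 + 2^k A` of `ker(GL₂(ℤ/2^{k+1}) → GL₂(ℤ/2^k)) ≅ M₂(𝔽₂)`. [cite: Serre1972, §4] [cite: LawsonWuthrich2016, §3] -/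
theorem exists_datum_of_mem_torsionFixing_zpow {k : ℕ} {g : absoluteGaloisGroup ℚ}
    (hg : g ∈ torsionFixing W ((2 : ℤ) ^ k)) :
    ∃ A : geomTorsion W (2 : ℤ) →+ geomTorsion W (2 : ℤ), ∀ (P : geomPoints W) (v : geomTorsion W (2 : ℤ)),
      ((2 : ℤ) ^ k) • P = (v : geomPoints W) → g • P = P + (A v : geomPoints W) := by
  have h2k : ((2 : ℤ) ^ k) ≠ 0 := pow_ne_zero _ two_ne_zero
  have hdiv := W.zsmul_geomPoints_surjective_of_charZero (n := (2 : ℤ) ^ k) h2k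
  choose root hroot using fun v : geomTorsion W (2 : ℤ) ↦ hdiv (v : geomPoints W)
  have hroot' : ∀ v : geomTorsion W (2 : ℤ), ((2 : ℤ) ^ k) • root v = (v : geomPoints W) := fun v ↦ hroot v
  -- `g • R - R ∈ E[2]` whenever `2^k R ∈ E[2]`
  have hmem : ∀ {P : geomPoints W} {v : geomTorsion W (2 : ℤ)}, ((2 : ℤ) ^ k) • P = (v : geomPoints W) →
      g • P - P ∈ geomTorsion W (2 : ℤ) := by
    intro P v hP
    rw [WeierstrassCurve.mem_geomTorsion_iff, zsmul_sub, ← WeierstrassCurve.smul_zsmul_geomPoints, sub_eq_zero]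
    apply smul_eq_self_of_zpow_zsmul_eq_zero W hg
    rw [smul_smul, ← pow_succ] -- `2^k • (2 • P) = 2^(k+1) • P`
    exact zpow_succ_zsmul_eq_zero_of_zpow_zsmul_eq W hP
  let A : geomTorsion W (2 : ℤ) →+ geomTorsion W (2 : ℤ) :=
    { toFun := fun v ↦ ⟨g • root v - root v, hmem (hroot' v)⟩
      map_zero' := Subtype.ext (by
        change g • root 0 - root 0 = 0
        rw [sub_eq_zero]
        apply smul_eq_self_of_zpow_zsmul_eq_zero W hg
        rw [hroot']; rfl)
      map_add' := fun v w ↦ Subtype.ext (by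
        change g • root (v + w) - root (v + w) = (g • root v - root v) + (g • root w - root w)
        have h : ((2 : ℤ) ^ k) • root (v + w) = ((2 : ℤ) ^ k) • (root v + root w) := by
          rw [zsmul_add, hroot', hroot', hroot']; rfl
        rw [smul_sub_eq_smul_sub_of_zpow_zsmul_eq W hg h, smul_add]
        abel) }
  refine ⟨A, fun P v hP ↦ ?_⟩
  change g • P = P + (g • root v - root v)
  have h := smul_sub_eq_smul_sub_of_zpow_zsmul_eq W hg (hP.trans (hroot' v).symm)
  rw [← h, add_sub_cancel]

/-- An element with a level-`k` datum lies in `Γ_{ℚ(E[2^k])}` (take `v = 0`). [folklore] -/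
theorem mem_torsionFixing_zpow_of_datum {k : ℕ} {g : absoluteGaloisGroup ℚ}
    {A : geomTorsion W (2 : ℤ) →+ geomTorsion W (2 : ℤ)}
    (hA : ∀ (P : geomPoints W) (v : geomTorsion W (2 : ℤ)), ((2 : ℤ) ^ k) • P = (v : geomPoints W) →
      g • P = P + (A v : geomPoints W)) :
    g ∈ torsionFixing W ((2 : ℤ) ^ k) := by
  rw [mem_torsionFixing_iff]
  intro P
  apply Subtype.ext
  have h := hA (P : geomPoints W) 0 (by rw [(WeierstrassCurve.mem_geomTorsion_iff W _ _).mp P.2]; rfl)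
  rw [map_zero, AddSubgroup.coe_zero, add_zero] at h
  exact h

/-- **The datum determines `g` modulo `Γ_{ℚ(E[2^{k+1}])}`**: two elements with the same level-`k` datum
differ by an element fixing `E[2^{k+1}]`. [folklore] -/
theorem mul_inv_mem_torsionFixing_zpow_succ_of_datum {k : ℕ} (hk : 1 ≤ k) {g g' : absoluteGaloisGroup ℚ}
    {A : geomTorsion W (2 : ℤ) →+ geomTorsion W (2 : ℤ)}
    (hg : ∀ (P : geomPoints W) (v : geomTorsion W (2 : ℤ)), ((2 : ℤ) ^ k) • P = (v : geomPoints W) →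
      g • P = P + (A v : geomPoints W))
    (hg' : ∀ (P : geomPoints W) (v : geomTorsion W (2 : ℤ)), ((2 : ℤ) ^ k) • P = (v : geomPoints W) →
      g' • P = P + (A v : geomPoints W)) :
    g' * g⁻¹ ∈ torsionFixing W ((2 : ℤ) ^ (k + 1)) := by
  have hgT : g ∈ torsionFixing W ((2 : ℤ) ^ k) := mem_torsionFixing_zpow_of_datum W hg
  rw [mem_torsionFixing_iff]
  intro P
  apply Subtype.ext
  change (g' * g⁻¹) • (P : geomPoints W) = (P : geomPoints W)
  have hP : ((2 : ℤ) ^ (k + 1)) • (P : geomPoints W) = 0 := (WeierstrassCurve.mem_geomTorsion_iff W _ _).mp P.2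
  -- `v := 2^k P ∈ E[2]`
  have hvmem : ((2 : ℤ) ^ k) • (P : geomPoints W) ∈ geomTorsion W (2 : ℤ) := by
    rw [WeierstrassCurve.mem_geomTorsion_iff, smul_smul, mul_comm, ← pow_succ, hP]
  set v : geomTorsion W (2 : ℤ) := ⟨((2 : ℤ) ^ k) • (P : geomPoints W), hvmem⟩ with hv
  set Q : geomPoints W := g⁻¹ • (P : geomPoints W) with hQ
  have hgQ : g • Q = P := by rw [hQ, smul_inv_smul]
  have h2Q : ((2 : ℤ) ^ k) • Q = (v : geomPoints W) := by
    -- `2^k Q = g⁻¹ (2^k P) = g⁻¹ v = v`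
    rw [hQ, ← WeierstrassCurve.smul_zsmul_geomPoints]
    have hfix : g • (v : geomPoints W) = v := smul_coe_geomTorsion_two_of_mem_torsionFixing_zpow W hk hgT v
    change g⁻¹ • (v : geomPoints W) = v
    nth_rewrite 1 [← hfix]
    rw [inv_smul_smul]
  have h1 := hg Q v h2Q
  rw [hgQ] at h1
  have h2 := hg' Q v h2Q
  rw [mul_smul, ← hQ, h2, ← h1]

/-- **Data add under products**: `g` with datum `A`, `g'` with datum `B` (level `k ≥ 1`) ⟹ `g g'` has datum
`A + B`. [folklore] -/
theorem datum_mul {k : ℕ} (hk : 1 ≤ k) {g g' : absoluteGaloisGroup ℚ}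
    {A B : geomTorsion W (2 : ℤ) →+ geomTorsion W (2 : ℤ)}
    (hg : ∀ (P : geomPoints W) (v : geomTorsion W (2 : ℤ)), ((2 : ℤ) ^ k) • P = (v : geomPoints W) →
      g • P = P + (A v : geomPoints W))
    (hg' : ∀ (P : geomPoints W) (v : geomTorsion W (2 : ℤ)), ((2 : ℤ) ^ k) • P = (v : geomPoints W) →
      g' • P = P + (B v : geomPoints W)) :
    ∀ (P : geomPoints W) (v : geomTorsion W (2 : ℤ)), ((2 : ℤ) ^ k) • P = (v : geomPoints W) →
      (g * g') • P = P + ((A + B) v : geomPoints W) := by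
  intro P v hP
  have hgT : g ∈ torsionFixing W ((2 : ℤ) ^ k) := mem_torsionFixing_zpow_of_datum W hg
  have hfix : g • ((B v : geomTorsion W (2 : ℤ)) : geomPoints W) = B v :=
    smul_coe_geomTorsion_two_of_mem_torsionFixing_zpow W hk hgT (B v)
  rw [mul_smul, hg' P v hP, smul_add, hg P v hP, hfix, AddMonoidHom.add_apply, AddSubgroup.coe_add]
  abel

/-- **Data conjugate like matrices**: `g` with datum `A` ⟹ `τ g τ⁻¹` has datum `τ ∘ A ∘ τ⁻¹`. [folklore] -/
theorem datum_conj {k : ℕ} {g : absoluteGaloisGroup ℚ} {A : geomTorsion W (2 : ℤ) →+ geomTorsion W (2 : ℤ)}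
    (hg : ∀ (P : geomPoints W) (v : geomTorsion W (2 : ℤ)), ((2 : ℤ) ^ k) • P = (v : geomPoints W) →
      g • P = P + (A v : geomPoints W)) (τ : absoluteGaloisGroup ℚ) :
    ∀ (P : geomPoints W) (v : geomTorsion W (2 : ℤ)), ((2 : ℤ) ^ k) • P = (v : geomPoints W) →
      (τ * g * τ⁻¹) • P = P +
        ((((DistribSMul.toAddMonoidHom (geomTorsion W (2 : ℤ)) τ).comp
            (A.comp (DistribSMul.toAddMonoidHom (geomTorsion W (2 : ℤ)) τ⁻¹))) v : geomTorsion W (2 : ℤ)) :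
          geomPoints W) := by
  intro P v hP
  have hQ : ((2 : ℤ) ^ k) • (τ⁻¹ • P) = ((τ⁻¹ • v : geomTorsion W (2 : ℤ)) : geomPoints W) := by
    rw [← WeierstrassCurve.smul_zsmul_geomPoints, hP]; rfl
  rw [mul_smul, mul_smul, hg _ _ hQ, smul_add, smul_inv_smul, AddMonoidHom.comp_apply, AddMonoidHom.comp_apply,
    DistribSMul.toAddMonoidHom_apply, DistribSMul.toAddMonoidHom_apply]
  rfl

/-- **Every `A` occurs as a level-`k` datum when `ρ_{E,2^{k+1}}` is onto** (realise the involution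
`P ↦ P + A(2^k P)` of `E[2^{k+1}]`). [cite: Serre1972, §4] [cite: LawsonWuthrich2016, §3] -/
theorem exists_datum_eq_of_hasSurjectiveModNGaloisRep {k : ℕ} (hk : 1 ≤ k)
    (hsurj : W.HasSurjectiveModNGaloisRep ((2 : ℤ) ^ (k + 1)))
    (A : geomTorsion W (2 : ℤ) →+ geomTorsion W (2 : ℤ)) :
    ∃ g : absoluteGaloisGroup ℚ, ∀ (P : geomPoints W) (v : geomTorsion W (2 : ℤ)),
      ((2 : ℤ) ^ k) • P = (v : geomPoints W) → g • P = P + (A v : geomPoints W) := by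
  have h2le : geomTorsion W (2 : ℤ) ≤ geomTorsion W ((2 : ℤ) ^ (k + 1)) :=
    W.geomTorsion_le_of_dvd (dvd_pow_self 2 (Nat.succ_ne_zero k))
  -- `2^k P ∈ E[2]` for `P ∈ E[2^{k+1}]`
  have hvmem : ∀ P : geomTorsion W ((2 : ℤ) ^ (k + 1)), ((2 : ℤ) ^ k) • (P : geomPoints W) ∈ geomTorsion W (2 : ℤ) := by
    intro P
    rw [WeierstrassCurve.mem_geomTorsion_iff, smul_smul, mul_comm, ← pow_succ]
    exact (WeierstrassCurve.mem_geomTorsion_iff W _ _).mp P.2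
  let N : geomTorsion W ((2 : ℤ) ^ (k + 1)) →+ geomTorsion W ((2 : ℤ) ^ (k + 1)) :=
    { toFun := fun P ↦ AddSubgroup.inclusion h2le (A ⟨((2 : ℤ) ^ k) • (P : geomPoints W), hvmem P⟩)
      map_zero' := by
        have h0 : (⟨((2 : ℤ) ^ k) • ((0 : geomTorsion W ((2 : ℤ) ^ (k + 1))) : geomPoints W), hvmem 0⟩ :
            geomTorsion W (2 : ℤ)) = 0 :=
          Subtype.ext (by change ((2 : ℤ) ^ k) • (0 : geomPoints W) = 0; exact zsmul_zero _)
        rw [h0, map_zero, map_zero]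
      map_add' := fun P Q ↦ by
        have h : (⟨((2 : ℤ) ^ k) • ((P + Q : geomTorsion W ((2 : ℤ) ^ (k + 1))) : geomPoints W), hvmem (P + Q)⟩ :
            geomTorsion W (2 : ℤ)) =
            ⟨((2 : ℤ) ^ k) • (P : geomPoints W), hvmem P⟩ + ⟨((2 : ℤ) ^ k) • (Q : geomPoints W), hvmem Q⟩ :=
          Subtype.ext (by
            change ((2 : ℤ) ^ k) • ((P : geomPoints W) + (Q : geomPoints W)) =
              ((2 : ℤ) ^ k) • (P : geomPoints W) + ((2 : ℤ) ^ k) • (Q : geomPoints W)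
            exact zsmul_add _ _ _)
        rw [h, map_add, map_add] }
  have hN : ∀ P : geomTorsion W ((2 : ℤ) ^ (k + 1)), (N P : geomPoints W) =
      (A ⟨((2 : ℤ) ^ k) • (P : geomPoints W), hvmem P⟩ : geomPoints W) := fun P ↦ rfl
  -- `N` kills points killed by `2^k`, in particular its own values (`k ≥ 1`)
  have hN0 : ∀ P : geomTorsion W ((2 : ℤ) ^ (k + 1)), ((2 : ℤ) ^ k) • (P : geomPoints W) = 0 → N P = 0 := by
    intro P hP
    apply Subtype.ext
    rw [hN]
    have h0 : (⟨((2 : ℤ) ^ k) • (P : geomPoints W), hvmem P⟩ : geomTorsion W (2 : ℤ)) = 0 := Subtype.ext hP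
    rw [h0, map_zero]; rfl
  have hNN : ∀ P : geomTorsion W ((2 : ℤ) ^ (k + 1)), N (N P) = 0 := by
    intro P
    apply hN0
    rw [hN]
    exact zpow_zsmul_coe_geomTorsion_two W hk _
  have hNself : ∀ P : geomTorsion W ((2 : ℤ) ^ (k + 1)), N P + N P = 0 := fun P ↦
    Subtype.ext (by rw [AddSubgroup.coe_add, hN]; exact coe_add_self_geomTorsion_two W _)
  let u : geomTorsion W ((2 : ℤ) ^ (k + 1)) ≃+ geomTorsion W ((2 : ℤ) ^ (k + 1)) :=
    { toFun := fun P ↦ P + N P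
      invFun := fun P ↦ P + N P
      left_inv := fun P ↦ by
        simp only [map_add, hNN, add_zero]
        rw [add_assoc, hNself, add_zero]
      right_inv := fun P ↦ by
        simp only [map_add, hNN, add_zero]
        rw [add_assoc, hNself, add_zero]
      map_add' := fun P Q ↦ by rw [map_add]; abel }
  obtain ⟨σ, hσ⟩ := hsurj (Multiplicative.ofAdd u)
  refine ⟨σ, fun P v hP ↦ ?_⟩
  have hPmem : P ∈ geomTorsion W ((2 : ℤ) ^ (k + 1)) :=
    (WeierstrassCurve.mem_geomTorsion_iff W _ _).mpr (zpow_succ_zsmul_eq_zero_of_zpow_zsmul_eq W hP)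
  have h := galoisRepTorsion_apply W ((2 : ℤ) ^ (k + 1)) σ ⟨P, hPmem⟩
  rw [hσ, toAdd_ofAdd] at h
  have h' := congrArg (fun x : geomTorsion W ((2 : ℤ) ^ (k + 1)) ↦ (x : geomPoints W)) h
  change ((⟨P, hPmem⟩ + N ⟨P, hPmem⟩ : geomTorsion W ((2 : ℤ) ^ (k + 1))) : geomPoints W) = σ • P at h'
  rw [← h', AddSubgroup.coe_add, hN]
  have hv : (⟨((2 : ℤ) ^ k) • ((⟨P, hPmem⟩ : geomTorsion W ((2 : ℤ) ^ (k + 1))) : geomPoints W), hvmem _⟩ :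
      geomTorsion W (2 : ℤ)) = v := Subtype.ext hP
  rw [hv]

end Datum

/-! ## §41 Squaring: `(1 + 2^k A)² ≡ 1 + 2^{k+1} A` for `k ≥ 2`, and `(1 + 2A)² = 1 + 4(A + A²)` -/

section Squaring

variable (W : WeierstrassCurve ℚ)

/-- `2^j R = 0 ⟹ 2^k R = 0` for `j ≤ k`. [folklore] -/
theorem zpow_zsmul_eq_zero_of_le {j k : ℕ} (hjk : j ≤ k) {R : geomPoints W} (hR : ((2 : ℤ) ^ j) • R = 0) :
    ((2 : ℤ) ^ k) • R = 0 := by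
  obtain ⟨i, rfl⟩ := Nat.exists_eq_add_of_le hjk
  rw [pow_add, mul_comm, mul_zsmul, hR, zsmul_zero]

/-- **SQUARING AT LEVEL `k ≥ 2`: the level-`(k+1)` datum of `g²` is the level-`k` datum of `g`.** For
`g ∈ Γ_{ℚ(E[2^k])}` with `gP = P + A(2^k P)` on `E[2^{k+1}]`: `g²Q = Q + A(2^{k+1} Q)` on `E[2^{k+2}]`
(`R := gQ − Q` has `2R = A(2^{k+1}Q) ∈ E[2]`, so `R ∈ E[4] ⊆ E[2^k]` is FIXED by `g` — this is where `k ≥ 2`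
enters — and `g²Q = Q + 2R`). Matrix form: `(1 + 2^k A)² = 1 + 2^{k+1}A + 2^{2k}A² ≡ 1 + 2^{k+1} A (mod 2^{k+2})`.
[cite: LawsonWuthrich2016, §3] [cite: Serre1972, §4] -/
theorem datum_sq_of_two_le {k : ℕ} (hk : 2 ≤ k) {g : absoluteGaloisGroup ℚ}
    {A : geomTorsion W (2 : ℤ) →+ geomTorsion W (2 : ℤ)}
    (hg : ∀ (P : geomPoints W) (v : geomTorsion W (2 : ℤ)), ((2 : ℤ) ^ k) • P = (v : geomPoints W) →
      g • P = P + (A v : geomPoints W)) :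
    ∀ (Q : geomPoints W) (v : geomTorsion W (2 : ℤ)), ((2 : ℤ) ^ (k + 1)) • Q = (v : geomPoints W) →
      (g * g) • Q = Q + (A v : geomPoints W) := by
  intro Q v hQ
  have hgT : g ∈ torsionFixing W ((2 : ℤ) ^ k) := mem_torsionFixing_zpow_of_datum W hg
  have hP : ((2 : ℤ) ^ k) • ((2 : ℤ) • Q) = (v : geomPoints W) := by
    rw [smul_smul, ← pow_succ, hQ]
  have h2Q := hg _ v hP
  set R : geomPoints W := g • Q - Q with hR
  have h2R : (2 : ℤ) • R = (A v : geomPoints W) := by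
    rw [hR, zsmul_sub, ← WeierstrassCurve.smul_zsmul_geomPoints, h2Q, add_sub_cancel_left]
  have h4R : ((2 : ℤ) ^ 2) • R = 0 := by
    rw [pow_succ, pow_one, mul_zsmul, h2R]
    exact (WeierstrassCurve.mem_geomTorsion_iff W 2 _).mp (A v).2
  have hRfix : g • R = R := smul_eq_self_of_zpow_zsmul_eq_zero W hgT (zpow_zsmul_eq_zero_of_le W hk h4R)
  have hgQ : g • Q = Q + R := by rw [hR, add_sub_cancel]
  rw [mul_smul, hgQ, smul_add, hgQ, hRfix, add_assoc, ← two_zsmul, h2R]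

/-- **SQUARING AT LEVEL `1`: the level-`2` datum of `s²` is `B + B²`.** For `s ∈ Γ_{ℚ(E[2])}` with
`sP = P + B(2P)` on `E[4]`: `s²Q = Q + (B + B∘B)(4Q)` on `E[8]` (`R := sQ − Q ∈ E[4]` is now MOVED by `s`:
`sR = R + B(2R) = R + B(B(4Q))`). Matrix form: `(1 + 2B)² = 1 + 4(B + B²)`. [cite: LawsonWuthrich2016, §3]
[cite: Serre1972, §4] -/
theorem datum_sq_one {s : absoluteGaloisGroup ℚ} {B : geomTorsion W (2 : ℤ) →+ geomTorsion W (2 : ℤ)}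
    (hs : ∀ (P : geomPoints W) (v : geomTorsion W (2 : ℤ)), ((2 : ℤ) ^ 1) • P = (v : geomPoints W) →
      s • P = P + (B v : geomPoints W)) :
    ∀ (Q : geomPoints W) (v : geomTorsion W (2 : ℤ)), ((2 : ℤ) ^ 2) • Q = (v : geomPoints W) →
      (s * s) • Q = Q + ((B + B.comp B) v : geomPoints W) := by
  intro Q v hQ
  have hP : ((2 : ℤ) ^ 1) • ((2 : ℤ) • Q) = (v : geomPoints W) := by
    rw [smul_smul, ← pow_succ, hQ]
  have h2Q := hs _ v hP
  set R : geomPoints W := s • Q - Q with hR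
  have h2R : (2 : ℤ) • R = (B v : geomPoints W) := by
    rw [hR, zsmul_sub, ← WeierstrassCurve.smul_zsmul_geomPoints, h2Q, add_sub_cancel_left]
  have hR1 : ((2 : ℤ) ^ 1) • R = ((B v : geomTorsion W (2 : ℤ)) : geomPoints W) := by rw [pow_one, h2R]
  have hsR := hs R (B v) hR1
  have hsQ : s • Q = Q + R := by rw [hR, add_sub_cancel]
  rw [mul_smul, hsQ, smul_add, hsQ, hsR, AddMonoidHom.add_apply, AddMonoidHom.comp_apply, AddSubgroup.coe_add,
    ← h2R, two_zsmul]
  abel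

end Squaring

/-! ## §42 `Hom_{GL₂(𝔽₂)}(M₂(𝔽₂)/⟨A + A²⟩, 𝔽₂²) = 0` (the finite computation) -/

section TwoByTwoSq

/-- **An additive `GL₂(𝔽₂)`-equivariant map `M₂(𝔽₂) → 𝔽₂²` killing every `A + A²` is ZERO.** The elements
`A + A²` span the trace-zero matrices (`E₁₂ = E₁₂ + E₁₂²`, `E₂₁ = E₂₁ + E₂₁²`,
`I = (E₁₂+E₂₁) + (E₁₂+E₂₁)²`), so such a `G` factors through the trace `M₂(𝔽₂) → 𝔽₂`, a TRIVIAL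
`GL₂(𝔽₂)`-module; equivariance then puts `G(E₁₁)` in `(𝔽₂²)^{GL₂(𝔽₂)} = 0` (swap and shear), and `G = 0` by
`twoByTwo_equivariant_eq_zero`. This is `Hom_{GL₂(𝔽₂)}(U₃/Φ(U₃), 𝔽₂²) → Hom_{GL₂(𝔽₂)}(U₂/Φ, 𝔽₂²)` being… the
computation behind `H¹(GL₂(ℤ/8), 𝔽₂²) = H¹(GL₂(ℤ/4), 𝔽₂²)`. [cite: LawsonWuthrich2016, §3 (the case p = 2)] -/
theorem twoByTwo_equivariant_eq_zero_of_sq (G : Matrix (Fin 2) (Fin 2) (ZMod 2) →+ (Fin 2 → ZMod 2))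
    (hG : ∀ (g g' : Matrix (Fin 2) (Fin 2) (ZMod 2)) (M : Matrix (Fin 2) (Fin 2) (ZMod 2)), g * g' = 1 → G (g * M * g') = g *ᵥ G M)
    (hsq : ∀ M : Matrix (Fin 2) (Fin 2) (ZMod 2), G (M + M * M) = 0) : G = 0 := by
  have e12 : (Matrix.single 0 1 1 : Matrix (Fin 2) (Fin 2) (ZMod 2)) + Matrix.single 0 1 1 * Matrix.single 0 1 1 =
      Matrix.single 0 1 1 := by
    decide
  have e21 : (Matrix.single 1 0 1 : Matrix (Fin 2) (Fin 2) (ZMod 2)) + Matrix.single 1 0 1 * Matrix.single 1 0 1 =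
      Matrix.single 1 0 1 := by
    decide
  have eI : (Matrix.single 0 1 1 : Matrix (Fin 2) (Fin 2) (ZMod 2)) + Matrix.single 1 0 1 +
      (Matrix.single 0 1 1 + Matrix.single 1 0 1) * (Matrix.single 0 1 1 + Matrix.single 1 0 1) =
      Matrix.single 0 1 1 + Matrix.single 1 0 1 + (Matrix.single 0 0 1 + Matrix.single 1 1 1) := by
    decide
  have R12 : G (Matrix.single 0 1 1) = 0 := by rw [← e12]; exact hsq _
  have R21 : G (Matrix.single 1 0 1) = 0 := by rw [← e21]; exact hsq _
  have RI : G (Matrix.single 0 0 1) + G (Matrix.single 1 1 1) = 0 := by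
    have h := hsq (Matrix.single 0 1 1 + Matrix.single 1 0 1)
    rw [eI, map_add, map_add, map_add, R12, R21, zero_add, zero_add] at h
    exact h
  set w := G (Matrix.single 0 0 1) with hw
  have hs : (!![0, 1; 1, 0] : Matrix (Fin 2) (Fin 2) (ZMod 2)) * !![0, 1; 1, 0] = 1 := by decide
  have ht : (!![1, 1; 0, 1] : Matrix (Fin 2) (Fin 2) (ZMod 2)) * !![1, 1; 0, 1] = 1 := by decide
  have e1 : (!![0, 1; 1, 0] : Matrix (Fin 2) (Fin 2) (ZMod 2)) * Matrix.single 0 0 1 * !![0, 1; 1, 0] = Matrix.single 1 1 1 := by decide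
  have e2 : (!![1, 1; 0, 1] : Matrix (Fin 2) (Fin 2) (ZMod 2)) * Matrix.single 0 0 1 * !![1, 1; 0, 1] =
      Matrix.single 0 0 1 + Matrix.single 0 1 1 := by decide
  have Rs : G (Matrix.single 1 1 1) = !![0, 1; 1, 0] *ᵥ w := by rw [← e1, hG _ _ _ hs]
  have Rt : w = !![1, 1; 0, 1] *ᵥ w := by
    have h := hG _ _ (Matrix.single 0 0 1) ht
    rw [e2, map_add, R12, add_zero] at h
    exact h
  have key : ∀ v : Fin 2 → ZMod 2,
      v + (!![0, 1; 1, 0] : Matrix (Fin 2) (Fin 2) (ZMod 2)) *ᵥ v = 0 →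
        v = (!![1, 1; 0, 1] : Matrix (Fin 2) (Fin 2) (ZMod 2)) *ᵥ v → v = 0 := by
    decide
  have hw0 : w = 0 := key w (by rw [← Rs]; exact RI) Rt
  exact twoByTwo_equivariant_eq_zero G hG hw0

end TwoByTwoSq

end Summit.BirchSwinnertonDyer.BirchSwinnertonDyer.Theorems.GenusKolyTwistingPrime

end
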